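import Summits.Ventures.PercRepro.S1ConeFourPlane

/-!
# PercRepro — THE CANDIDATES THROUGH A POINT ON FOUR TRIANGLES: AT MOST `8` (p2, gen 25; SUBCLAIM-S1 §6.9 (xii) T4)

On a `10`-point matroid with (C1), (C2), let `x` lie on exactly four triangles `L₁, …, L₄` (cone `9` points, one
outside point `s`). A CANDIDATE (a `4`-set `K ∋ x` of rank `3` containing no `Lᵢ`) has at most one point on each
`Lᵢ ∖ x` and cannot take three cone points (S1ConeGeometry (a)), so it is `{x, a, b, s}` with `a ∈ Lᵢ`, `b ∈ Lⱼ`.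
If `s` lies in the planes of two pairs sharing a line `Lᵢ` then the plane `cl (Lᵢ ∪ s)` holds three lines — `7`
points (S1ConeFourPlane); so the pairs `{i, j}` in use form a matching of the four lines: at most two pairs, at
most `4` candidates each (S1ConeCandidates). Hence **`#{four-circuits ∋ x} + #{triangles ∌ x} ≤ 8`**.

* **`ncard_fourCircuits_through_add_triangles_avoiding_le_four`** — the theorem.
Axioms: standard.
-/

open scoped Matroid

namespace PercRepro

namespace S1

open Set

variable {α : Type}

open Classical in
/-- **AT MOST `8` CANDIDATES THROUGH A POINT ON EXACTLY FOUR TRIANGLES** of a `10`-point matroid with (C1), (C2): `#{four-circuits ∋ x} + #{triangles ∌ x} ≤ 8`. -/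
theorem ncard_fourCircuits_through_add_triangles_avoiding_le_four (N : Matroid α) [N.Finite]
    (hC1 : ∀ L ⊆ N.E, N.eRk L = 2 → L.ncard ≤ 3) (hC2 : ∀ P ⊆ N.E, N.eRk P ≤ 3 → P.ncard ≤ 6)
    {x : α} (hn : N.E.ncard = 10)
    {L₁ L₂ L₃ L₄ : Set α} (hL₁ : L₁ ∈ ThmN.trianglesThrough N x) (hL₂ : L₂ ∈ ThmN.trianglesThrough N x)
    (hL₃ : L₃ ∈ ThmN.trianglesThrough N x) (hL₄ : L₄ ∈ ThmN.trianglesThrough N x)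
    (h12 : L₁ ≠ L₂) (h13 : L₁ ≠ L₃) (h14 : L₁ ≠ L₄) (h23 : L₂ ≠ L₃) (h24 : L₂ ≠ L₄) (h34 : L₃ ≠ L₄)
    (hall : ∀ C ∈ ThmN.trianglesThrough N x, C = L₁ ∨ C = L₂ ∨ C = L₃ ∨ C = L₄) :
    {C : Set α | N.IsCircuit C ∧ C.ncard = 4 ∧ x ∈ C}.ncard +
      {C : Set α | N.IsCircuit C ∧ C.ncard = 3 ∧ x ∉ C}.ncard ≤ 8 := by
  have hEfin : N.E.Finite := N.ground_finite
  have hL₁E := hL₁.1.subset_ground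
  have hL₂E := hL₂.1.subset_ground
  have hL₃E := hL₃.1.subset_ground
  have hL₄E := hL₄.1.subset_ground
  have hxE : x ∈ N.E := hL₁E hL₁.2.2
  have hmemL : ∀ L, (L = L₁ ∨ L = L₂ ∨ L = L₃ ∨ L = L₄) → L ∈ ThmN.trianglesThrough N x := by
    rintro L (rfl | rfl | rfl | rfl) <;> assumption
  -- the cone has `9` points, the outside `O` is a single point `s`
  have hcone9 : (L₁ ∪ L₂ ∪ L₃ ∪ L₄).ncard = 9 := by
    have h5 := ncard_union_eq_five_of_trianglesThrough N hC1 hL₁ hL₂ h12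
    have hint3 : (L₁ ∪ L₂) ∩ L₃ = {x} := by
      rw [Set.union_inter_distrib_right, ThmN.inter_eq_singleton_of_mem_trianglesThrough N hC1 hL₁ hL₃ h13,
        ThmN.inter_eq_singleton_of_mem_trianglesThrough N hC1 hL₂ hL₃ h23, Set.union_self]
    have h7 : (L₁ ∪ L₂ ∪ L₃).ncard = 7 := by
      have h := Set.ncard_union_add_ncard_inter (L₁ ∪ L₂) L₃ (hEfin.subset (Set.union_subset hL₁E hL₂E))
        (hEfin.subset hL₃E)
      rw [hint3, Set.ncard_singleton, h5, hL₃.2.1] at h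
      omega
    have hint4 : (L₁ ∪ L₂ ∪ L₃) ∩ L₄ = {x} := by
      rw [Set.union_inter_distrib_right, Set.union_inter_distrib_right,
        ThmN.inter_eq_singleton_of_mem_trianglesThrough N hC1 hL₁ hL₄ h14,
        ThmN.inter_eq_singleton_of_mem_trianglesThrough N hC1 hL₂ hL₄ h24,
        ThmN.inter_eq_singleton_of_mem_trianglesThrough N hC1 hL₃ hL₄ h34, Set.union_self, Set.union_self]
    have h := Set.ncard_union_add_ncard_inter (L₁ ∪ L₂ ∪ L₃) L₄
      (hEfin.subset (Set.union_subset (Set.union_subset hL₁E hL₂E) hL₃E)) (hEfin.subset hL₄E)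
    rw [hint4, Set.ncard_singleton, h7, hL₄.2.1] at h
    omega
  have hconeE : L₁ ∪ L₂ ∪ L₃ ∪ L₄ ⊆ N.E :=
    Set.union_subset (Set.union_subset (Set.union_subset hL₁E hL₂E) hL₃E) hL₄E
  set O := N.E \ (L₁ ∪ L₂ ∪ L₃ ∪ L₄) with hO
  have hO1 : O.ncard = 1 := by rw [hO, Set.ncard_sdiff hconeE (hEfin.subset hconeE), hn, hcone9]
  obtain ⟨s, hOs⟩ := Set.ncard_eq_one.1 hO1
  have hsO : s ∈ O := by rw [hOs]; exact Set.mem_singleton s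
  have hsE : s ∈ N.E := hsO.1
  have hsx : s ≠ x := fun h => hsO.2 (Or.inl (Or.inl (Or.inl (h ▸ hL₁.2.2))))
  have hsnot : ∀ L, (L = L₁ ∨ L = L₂ ∨ L = L₃ ∨ L = L₄) → s ∉ L := by
    rintro L (rfl | rfl | rfl | rfl) h
    · exact hsO.2 (Or.inl (Or.inl (Or.inl h)))
    · exact hsO.2 (Or.inl (Or.inl (Or.inr h)))
    · exact hsO.2 (Or.inl (Or.inr h))
    · exact hsO.2 (Or.inr h)
  have hclass : ∀ y ∈ N.E, y ≠ x → (y ∈ L₁ ∨ y ∈ L₂ ∨ y ∈ L₃ ∨ y ∈ L₄) ∨ y = s := by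
    intro y hy hyx
    by_cases h : y ∈ L₁ ∪ L₂ ∪ L₃ ∪ L₄
    · left
      rcases h with ((h | h) | h) | h
      · exact Or.inl h
      · exact Or.inr (Or.inl h)
      · exact Or.inr (Or.inr (Or.inl h))
      · exact Or.inr (Or.inr (Or.inr h))
    · right
      have : y ∈ O := ⟨hy, h⟩
      rw [hOs] at this
      exact this
  -- the candidates
  set 𝒦 := {K : Set α | K ⊆ N.E ∧ x ∈ K ∧ K.ncard = 4 ∧ N.eRk K = 3 ∧ ¬ L₁ ⊆ K ∧ ¬ L₂ ⊆ K ∧ ¬ L₃ ⊆ K ∧ ¬ L₄ ⊆ K}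
    with h𝒦
  have h𝒦fin : 𝒦.Finite := hEfin.finite_subsets.subset (fun K hK => hK.1)
  have h𝒦spec : ∀ K ∈ 𝒦, K ⊆ N.E ∧ x ∈ K ∧ K.ncard = 4 ∧ N.eRk K = 3 ∧ ¬ L₁ ⊆ K ∧ ¬ L₂ ⊆ K ∧ ¬ L₃ ⊆ K ∧ ¬ L₄ ⊆ K :=
    fun K hK => hK
  have hnoLK : ∀ K ∈ 𝒦, ∀ L, (L = L₁ ∨ L = L₂ ∨ L = L₃ ∨ L = L₄) → ¬ L ⊆ K := by
    rintro K hK L (rfl | rfl | rfl | rfl)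
    · exact hK.2.2.2.2.1
    · exact hK.2.2.2.2.2.1
    · exact hK.2.2.2.2.2.2.1
    · exact hK.2.2.2.2.2.2.2
  have hfinE : ∀ X ⊆ N.E, N.eRk X ≠ ⊤ := fun X hX =>
    ((N.eRk_le_encard X).trans_lt (hEfin.subset hX).encard_lt_top).ne
  ----------------------------------------------------------------
  -- (1) the four-circuits through `x` and the sets `{x} ∪ T` are candidates
  ----------------------------------------------------------------
  set A := {C : Set α | N.IsCircuit C ∧ C.ncard = 4 ∧ x ∈ C} with hA
  set 𝒯' := {C : Set α | N.IsCircuit C ∧ C.ncard = 3 ∧ x ∉ C} with h𝒯'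
  have hnosub : ∀ C, N.IsCircuit C → C.ncard = 4 → ∀ L ∈ ThmN.trianglesThrough N x, ¬ L ⊆ C := by
    intro C hC h4 L hL hsub
    have h := hL.1.eq_of_subset_isCircuit hC hsub
    have h3 := hL.2.1
    rw [h] at h3; omega
  have hA𝒦 : A ⊆ 𝒦 := by
    rintro C ⟨hC, h4, hxC⟩
    have hCE := hC.subset_ground
    have hCfin : C.Finite := hEfin.subset hCE
    refine ⟨hCE, hxC, h4, ?_, hnosub C hC h4 L₁ hL₁, hnosub C hC h4 L₂ hL₂, hnosub C hC h4 L₃ hL₃,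
      hnosub C hC h4 L₄ hL₄⟩
    have h := hC.eRk_add_one_eq
    rw [← hCfin.cast_ncard_eq, h4] at h
    obtain ⟨r, hr⟩ := ENat.ne_top_iff_exists.1 (hfinE C hCE)
    rw [← hr] at h ⊢
    have : r + 1 = 4 := by exact_mod_cast h
    norm_cast; omega
  have hB𝒦 : (insert x) '' 𝒯' ⊆ 𝒦 := by
    rintro K ⟨T, ⟨hT, hT3, hxT⟩, rfl⟩
    have hTE := hT.subset_ground
    have hTfin : T.Finite := hEfin.subset hTE
    have hTr : N.eRk T = 2 := by
      have h := hT.eRk_add_one_eq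
      rw [← hTfin.cast_ncard_eq, hT3] at h
      obtain ⟨r, hr⟩ := ENat.ne_top_iff_exists.1 (hfinE T hTE)
      rw [← hr] at h ⊢
      have : r + 1 = 3 := by exact_mod_cast h
      norm_cast; omega
    have hnoL : ∀ L ∈ ThmN.trianglesThrough N x, ¬ L ⊆ insert x T := by
      intro L hL hsub
      have h2 : (L \ {x}).ncard = 2 := by rw [Set.ncard_sdiff_singleton_of_mem hL.2.2, hL.2.1]
      obtain ⟨y, z, hyz, hyz'⟩ := Set.ncard_eq_two.1 h2
      have hy : y ∈ L \ {x} := by rw [hyz']; simp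
      have hz : z ∈ L \ {x} := by rw [hyz']; simp
      have hyT : y ∈ T := by
        rcases hsub hy.1 with h | h
        · exact absurd h hy.2
        · exact h
      have hzT : z ∈ T := by
        rcases hsub hz.1 with h | h
        · exact absurd h hz.2
        · exact h
      have hTy : T ∈ ThmN.trianglesThrough N y := ⟨hT, hT3, hyT⟩
      have hLy : L ∈ ThmN.trianglesThrough N y := ⟨hL.1, hL.2.1, hy.1⟩
      have hneTL : T ≠ L := fun h => hxT (h ▸ hL.2.2)
      have hint := ThmN.inter_eq_singleton_of_mem_trianglesThrough N hC1 hTy hLy hneTL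
      have : z ∈ T ∩ L := ⟨hzT, hz.1⟩
      rw [hint] at this
      exact hyz (Set.mem_singleton_iff.1 this).symm
    refine ⟨Set.insert_subset hxE hTE, Set.mem_insert x T, ?_, ?_, hnoL L₁ hL₁, hnoL L₂ hL₂, hnoL L₃ hL₃,
      hnoL L₄ hL₄⟩
    · rw [Set.ncard_insert_of_notMem hxT hTfin, hT3]
    · have hle : N.eRk (insert x T) ≤ 3 := by
        calc N.eRk (insert x T) ≤ N.eRk T + 1 := N.eRk_insert_le_add_one x T
          _ = 3 := by rw [hTr]; rfl
      obtain ⟨r, hr⟩ := ENat.ne_top_iff_exists.1 (hfinE _ (Set.insert_subset hxE hTE))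
      have hr3 : r ≤ 3 := by rw [← hr] at hle; exact_mod_cast hle
      have hr2 : ¬ r ≤ 2 := by
        intro hr2
        have hle2 : N.eRk (insert x T) ≤ N.eRk T := by
          rw [← hr, hTr]; exact_mod_cast hr2
        have := mem_closure_of_eRk_insert_le N hTE hxE hle2
        rw [closure_eq_of_triangle N hC1 hT hT3] at this
        exact hxT this
      rw [← hr]
      norm_cast; omega
  have hdisj : Disjoint A ((insert x) '' 𝒯') := by
    rw [Set.disjoint_left]
    rintro K ⟨hK, -, -⟩ ⟨T, ⟨hT, -, hxT⟩, rfl⟩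
    exact hK.not_ssubset hT (Set.ssubset_insert hxT)
  have hAfin : A.Finite := (finite_fourCircuits N).subset (fun C hC => ⟨hC.1, hC.2.1⟩)
  have h𝒯'fin : 𝒯'.Finite := (finite_triangles N).subset (fun C hC => ⟨hC.1, hC.2.1⟩)
  have hBcard : ((insert x) '' 𝒯').ncard = 𝒯'.ncard := by
    apply Set.InjOn.ncard_image
    rintro T ⟨-, -, hxT⟩ T' ⟨-, -, hxT'⟩ h
    ext y
    constructor
    · intro hy
      have : y ∈ insert x T' := h ▸ Set.mem_insert_of_mem x hy
      rcases this with rfl | h'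
      · exact absurd hy hxT
      · exact h'
    · intro hy
      have : y ∈ insert x T := h ▸ Set.mem_insert_of_mem x hy
      rcases this with rfl | h'
      · exact absurd hy hxT'
      · exact h'
  have hstep1 : A.ncard + 𝒯'.ncard ≤ 𝒦.ncard := by
    rw [← hBcard, ← Set.ncard_union_eq hdisj hAfin (h𝒯'fin.image _)]
    exact Set.ncard_le_ncard (Set.union_subset hA𝒦 hB𝒦) h𝒦fin
  refine hstep1.trans ?_
  ----------------------------------------------------------------
  -- (2) the candidates: `{x, a, b, s}` with `a ∈ Lᵢ`, `b ∈ Lⱼ`; the pairs `{i, j}` form a matching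
  ----------------------------------------------------------------
  -- a candidate has no point on each of three lines
  have hthree : ∀ K ∈ 𝒦, ∀ p q r, p ∈ K → q ∈ K → r ∈ K → p ≠ q → p ≠ r → q ≠ r → p ≠ x → q ≠ x → r ≠ x →
      ∀ Lp Lq Lr, (Lp = L₁ ∨ Lp = L₂ ∨ Lp = L₃ ∨ Lp = L₄) → (Lq = L₁ ∨ Lq = L₂ ∨ Lq = L₃ ∨ Lq = L₄) →
      (Lr = L₁ ∨ Lr = L₂ ∨ Lr = L₃ ∨ Lr = L₄) → p ∈ Lp → q ∈ Lq → r ∈ Lr → K = {x, p, q, r} → False := by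
    intro K hK p q r hp hq hr hpq hpr hqr hpx hqx hrx Lp Lq Lr hLp hLq hLr hpL hqL hrL hKeq
    obtain ⟨-, hxK, -, hKr, -⟩ := h𝒦spec K hK
    by_cases e1 : Lp = Lq
    · exact not_two_of_line (hmemL Lp hLp) hxK (hnoLK K hK Lp hLp) hp hq hpq hpx hqx hpL (e1 ▸ hqL)
    by_cases e2 : Lp = Lr
    · exact not_two_of_line (hmemL Lp hLp) hxK (hnoLK K hK Lp hLp) hp hr hpr hpx hrx hpL (e2 ▸ hrL)
    by_cases e3 : Lq = Lr
    · exact not_two_of_line (hmemL Lq hLq) hxK (hnoLK K hK Lq hLq) hq hr hqr hqx hrx hqL (e3 ▸ hrL)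
    rw [hKeq] at hKr
    exact not_eRk_three_cone N hC1 hC2 (hmemL Lp hLp) (hmemL Lq hLq) (hmemL Lr hLr) e1 e2 e3 hpL hpx hqL hqx
      hrL hrx hKr
  -- the pieces `F L L'`
  set F : Set α → Set α → Set (Set α) := fun L L' =>
    {K ∈ 𝒦 | ∃ a ∈ K, a ∈ L ∧ a ≠ x ∧ ∃ b ∈ K, b ∈ L' ∧ b ≠ x} with hF
  have hFsymm : ∀ L L' K, K ∈ F L L' → K ∈ F L' L := by
    rintro L L' K ⟨hK, a, haK, haL, hax, b, hbK, hbL', hbx⟩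
    exact ⟨hK, b, hbK, hbL', hbx, a, haK, haL, hax⟩
  -- every member of `F L L'` (distinct lines) is `{x, a, b, s}`
  have hshape : ∀ L L', (L = L₁ ∨ L = L₂ ∨ L = L₃ ∨ L = L₄) → (L' = L₁ ∨ L' = L₂ ∨ L' = L₃ ∨ L' = L₄) → L ≠ L' →
      ∀ K ∈ F L L', ∃ a b, a ∈ L ∧ a ≠ x ∧ b ∈ L' ∧ b ≠ x ∧ K = {x, a, b, s} := by
    rintro L L' hLm hL'm hne K ⟨hK, a, haK, haL, hax, b, hbK, hbL', hbx⟩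
    obtain ⟨hKE, hxK, hK4, hKr, -⟩ := h𝒦spec K hK
    have hab : a ≠ b := by
      rintro rfl
      have hint := ThmN.inter_eq_singleton_of_mem_trianglesThrough N hC1 (hmemL L hLm) (hmemL L' hL'm) hne
      have : a ∈ L ∩ L' := ⟨haL, hbL'⟩
      rw [hint] at this
      exact hax this
    obtain ⟨w, hwK, hwx, hwa, hwb, hKeq⟩ := exists_fourth_of_ncard_four hK4 hxK haK hbK (Ne.symm hax) (Ne.symm hbx) hab
    refine ⟨a, b, haL, hax, hbL', hbx, ?_⟩
    rcases hclass w (hKE hwK) hwx with hw | rfl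
    · exfalso
      obtain ⟨Lw, hLwm, hwL⟩ : ∃ Lw, (Lw = L₁ ∨ Lw = L₂ ∨ Lw = L₃ ∨ Lw = L₄) ∧ w ∈ Lw := by
        rcases hw with h | h | h | h
        · exact ⟨L₁, Or.inl rfl, h⟩
        · exact ⟨L₂, Or.inr (Or.inl rfl), h⟩
        · exact ⟨L₃, Or.inr (Or.inr (Or.inl rfl)), h⟩
        · exact ⟨L₄, Or.inr (Or.inr (Or.inr rfl)), h⟩
      exact hthree K hK a b w haK hbK hwK hab (Ne.symm hwa) (Ne.symm hwb) hax hbx hwx L L' Lw hLm hL'm hLwm haL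
        hbL' hwL hKeq
    · exact hKeq
  -- the matching constraint: `F L L'` and `F L L''` are not both nonempty
  have hmatch : ∀ L L' L'', (L = L₁ ∨ L = L₂ ∨ L = L₃ ∨ L = L₄) → (L' = L₁ ∨ L' = L₂ ∨ L' = L₃ ∨ L' = L₄) →
      (L'' = L₁ ∨ L'' = L₂ ∨ L'' = L₃ ∨ L'' = L₄) → L ≠ L' → L ≠ L'' → L' ≠ L'' →
      (F L L').ncard = 0 ∨ (F L L'').ncard = 0 := by
    intro L L' L'' hLm hL'm hL''m hne hne' hne''
    by_contra hcon
    push Not at hcon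
    obtain ⟨K, hK⟩ := Set.nonempty_of_ncard_ne_zero hcon.1
    obtain ⟨K', hK'⟩ := Set.nonempty_of_ncard_ne_zero hcon.2
    obtain ⟨a, b, haL, hax, hbL', hbx, hKeq⟩ := hshape L L' hLm hL'm hne K hK
    obtain ⟨a', c, ha'L, ha'x, hcL'', hcx, hK'eq⟩ := hshape L L'' hLm hL''m hne' K' hK'
    have hKr : N.eRk K = 3 := (h𝒦spec K hK.1).2.2.2.1
    have hK'r : N.eRk K' = 3 := (h𝒦spec K' hK'.1).2.2.2.1
    rw [hKeq] at hKr
    rw [hK'eq] at hK'r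
    exact not_two_planes_through_line N hC1 hC2 (hmemL L hLm) (hmemL L' hL'm) (hmemL L'' hL''m) hne hne' hne''
      haL hax ha'L ha'x hbL' hbx hcL'' hcx hsE (hsnot L hLm) hKr hK'r
  -- each piece has at most `4` members
  have hFle : ∀ L L' L'', (L = L₁ ∨ L = L₂ ∨ L = L₃ ∨ L = L₄) → (L' = L₁ ∨ L' = L₂ ∨ L' = L₃ ∨ L' = L₄) →
      (L'' = L₁ ∨ L'' = L₂ ∨ L'' = L₃ ∨ L'' = L₄) → L ≠ L' → L ≠ L'' → L' ≠ L'' → (F L L').ncard ≤ 4 := by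
    intro L L' L'' hLm hL'm hL''m hne hne' hne''
    exact ncard_candidates_two_lines_le_four N hC1 hC2 (hmemL L hLm) (hmemL L' hL'm) (hmemL L'' hL''m) hne hne' hne''
      𝒦 (fun K hK => ⟨hK.1, hK.2.1, hK.2.2.1, hK.2.2.2.1, hnoLK K hK L hLm, hnoLK K hK L' hL'm, hnoLK K hK L'' hL''m⟩)
  -- the covering
  have hcov : 𝒦 ⊆ F L₁ L₂ ∪ F L₁ L₃ ∪ F L₁ L₄ ∪ F L₂ L₃ ∪ F L₂ L₄ ∪ F L₃ L₄ := by
    intro K hK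
    obtain ⟨hKE, hxK, hK4, hKr, -⟩ := h𝒦spec K hK
    obtain ⟨u, v, w, hux, hvx, hwx, huv, huw, hvw, hKeq⟩ := exists_eq_insert_three_of_ncard_four hK4 hxK
    have huK : u ∈ K := by rw [hKeq]; simp
    have hvK : v ∈ K := by rw [hKeq]; simp
    have hwK : w ∈ K := by rw [hKeq]; simp
    -- two cone points on distinct lines, the third point `s`
    have hmem : ∀ p q, p ∈ K → q ∈ K → p ≠ q → p ≠ x → q ≠ x →
        (p ∈ L₁ ∨ p ∈ L₂ ∨ p ∈ L₃ ∨ p ∈ L₄) → (q ∈ L₁ ∨ q ∈ L₂ ∨ q ∈ L₃ ∨ q ∈ L₄) →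
        K ∈ F L₁ L₂ ∪ F L₁ L₃ ∪ F L₁ L₄ ∪ F L₂ L₃ ∪ F L₂ L₄ ∪ F L₃ L₄ := by
      intro p q hp hq hpq hpx hqx hpL hqL
      have hsame : ∀ L, (L = L₁ ∨ L = L₂ ∨ L = L₃ ∨ L = L₄) → p ∈ L → q ∈ L → False :=
        fun L hLm hpL hqL => not_two_of_line (hmemL L hLm) hxK (hnoLK K hK L hLm) hp hq hpq hpx hqx hpL hqL
      rcases hpL with hp1 | hp2 | hp3 | hp4 <;> rcases hqL with hq1 | hq2 | hq3 | hq4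
      all_goals first
        | exact (hsame L₁ (Or.inl rfl) ‹p ∈ L₁› ‹q ∈ L₁›).elim
        | exact (hsame L₂ (Or.inr (Or.inl rfl)) ‹p ∈ L₂› ‹q ∈ L₂›).elim
        | exact (hsame L₃ (Or.inr (Or.inr (Or.inl rfl))) ‹p ∈ L₃› ‹q ∈ L₃›).elim
        | exact (hsame L₄ (Or.inr (Or.inr (Or.inr rfl))) ‹p ∈ L₄› ‹q ∈ L₄›).elim
        | exact Or.inl (Or.inl (Or.inl (Or.inl (Or.inl ⟨hK, p, hp, ‹p ∈ L₁›, hpx, q, hq, ‹q ∈ L₂›, hqx⟩))))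
        | exact Or.inl (Or.inl (Or.inl (Or.inl (Or.inl ⟨hK, q, hq, ‹q ∈ L₁›, hqx, p, hp, ‹p ∈ L₂›, hpx⟩))))
        | exact Or.inl (Or.inl (Or.inl (Or.inl (Or.inr ⟨hK, p, hp, ‹p ∈ L₁›, hpx, q, hq, ‹q ∈ L₃›, hqx⟩))))
        | exact Or.inl (Or.inl (Or.inl (Or.inl (Or.inr ⟨hK, q, hq, ‹q ∈ L₁›, hqx, p, hp, ‹p ∈ L₃›, hpx⟩))))
        | exact Or.inl (Or.inl (Or.inl (Or.inr ⟨hK, p, hp, ‹p ∈ L₁›, hpx, q, hq, ‹q ∈ L₄›, hqx⟩)))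
        | exact Or.inl (Or.inl (Or.inl (Or.inr ⟨hK, q, hq, ‹q ∈ L₁›, hqx, p, hp, ‹p ∈ L₄›, hpx⟩)))
        | exact Or.inl (Or.inl (Or.inr ⟨hK, p, hp, ‹p ∈ L₂›, hpx, q, hq, ‹q ∈ L₃›, hqx⟩))
        | exact Or.inl (Or.inl (Or.inr ⟨hK, q, hq, ‹q ∈ L₂›, hqx, p, hp, ‹p ∈ L₃›, hpx⟩))
        | exact Or.inl (Or.inr ⟨hK, p, hp, ‹p ∈ L₂›, hpx, q, hq, ‹q ∈ L₄›, hqx⟩)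
        | exact Or.inl (Or.inr ⟨hK, q, hq, ‹q ∈ L₂›, hqx, p, hp, ‹p ∈ L₄›, hpx⟩)
        | exact Or.inr ⟨hK, p, hp, ‹p ∈ L₃›, hpx, q, hq, ‹q ∈ L₄›, hqx⟩
        | exact Or.inr ⟨hK, q, hq, ‹q ∈ L₃›, hqx, p, hp, ‹p ∈ L₄›, hpx⟩
    have hline3 : ∀ p q r, p ∈ K → q ∈ K → r ∈ K → p ≠ q → p ≠ r → q ≠ r → p ≠ x → q ≠ x → r ≠ x →
        (p ∈ L₁ ∨ p ∈ L₂ ∨ p ∈ L₃ ∨ p ∈ L₄) → (q ∈ L₁ ∨ q ∈ L₂ ∨ q ∈ L₃ ∨ q ∈ L₄) →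
        (r ∈ L₁ ∨ r ∈ L₂ ∨ r ∈ L₃ ∨ r ∈ L₄) → K = {x, p, q, r} → False := by
      intro p q r hp hq hr hpq hpr hqr hpx hqx hrx hpL hqL hrL hKeq'
      obtain ⟨Lp, hLpm, hpLp⟩ : ∃ Lp, (Lp = L₁ ∨ Lp = L₂ ∨ Lp = L₃ ∨ Lp = L₄) ∧ p ∈ Lp := by
        rcases hpL with h | h | h | h
        · exact ⟨L₁, Or.inl rfl, h⟩
        · exact ⟨L₂, Or.inr (Or.inl rfl), h⟩
        · exact ⟨L₃, Or.inr (Or.inr (Or.inl rfl)), h⟩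
        · exact ⟨L₄, Or.inr (Or.inr (Or.inr rfl)), h⟩
      obtain ⟨Lq, hLqm, hqLq⟩ : ∃ Lq, (Lq = L₁ ∨ Lq = L₂ ∨ Lq = L₃ ∨ Lq = L₄) ∧ q ∈ Lq := by
        rcases hqL with h | h | h | h
        · exact ⟨L₁, Or.inl rfl, h⟩
        · exact ⟨L₂, Or.inr (Or.inl rfl), h⟩
        · exact ⟨L₃, Or.inr (Or.inr (Or.inl rfl)), h⟩
        · exact ⟨L₄, Or.inr (Or.inr (Or.inr rfl)), h⟩
      obtain ⟨Lr, hLrm, hrLr⟩ : ∃ Lr, (Lr = L₁ ∨ Lr = L₂ ∨ Lr = L₃ ∨ Lr = L₄) ∧ r ∈ Lr := by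
        rcases hrL with h | h | h | h
        · exact ⟨L₁, Or.inl rfl, h⟩
        · exact ⟨L₂, Or.inr (Or.inl rfl), h⟩
        · exact ⟨L₃, Or.inr (Or.inr (Or.inl rfl)), h⟩
        · exact ⟨L₄, Or.inr (Or.inr (Or.inr rfl)), h⟩
      exact hthree K hK p q r hp hq hr hpq hpr hqr hpx hqx hrx Lp Lq Lr hLpm hLqm hLrm hpLp hqLq hrLr hKeq'
    rcases hclass u (hKE huK) hux with hu | rfl <;> rcases hclass v (hKE hvK) hvx with hv | rfl <;>
      rcases hclass w (hKE hwK) hwx with hw | rfl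
    · exact (hline3 u v w huK hvK hwK huv huw hvw hux hvx hwx hu hv hw hKeq).elim
    · exact hmem u v huK hvK huv hux hvx hu hv
    · exact hmem u w huK hwK huw hux hwx hu hw
    · exact absurd rfl hvw
    · exact hmem v w hvK hwK hvw hvx hwx hv hw
    · exact absurd rfl huw
    · exact absurd rfl huv
    · exact absurd rfl huv
  -- the count
  have hfinF : ∀ L L', (F L L').Finite := fun L L' => h𝒦fin.subset (fun K hK => hK.1)
  have hfinU : (F L₁ L₂ ∪ F L₁ L₃ ∪ F L₁ L₄ ∪ F L₂ L₃ ∪ F L₂ L₄ ∪ F L₃ L₄).Finite :=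
    (((((hfinF L₁ L₂).union (hfinF L₁ L₃)).union (hfinF L₁ L₄)).union (hfinF L₂ L₃)).union (hfinF L₂ L₄)).union
      (hfinF L₃ L₄)
  have hU1 := Set.ncard_union_le (F L₁ L₂) (F L₁ L₃)
  have hU2 := Set.ncard_union_le (F L₁ L₂ ∪ F L₁ L₃) (F L₁ L₄)
  have hU3 := Set.ncard_union_le (F L₁ L₂ ∪ F L₁ L₃ ∪ F L₁ L₄) (F L₂ L₃)
  have hU4 := Set.ncard_union_le (F L₁ L₂ ∪ F L₁ L₃ ∪ F L₁ L₄ ∪ F L₂ L₃) (F L₂ L₄)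
  have hU5 := Set.ncard_union_le (F L₁ L₂ ∪ F L₁ L₃ ∪ F L₁ L₄ ∪ F L₂ L₃ ∪ F L₂ L₄) (F L₃ L₄)
  have hK := Set.ncard_le_ncard hcov hfinU
  have m1 := hmemL L₁ (Or.inl rfl)
  have e1 : L₁ = L₁ ∨ L₁ = L₂ ∨ L₁ = L₃ ∨ L₁ = L₄ := Or.inl rfl
  have e2 : L₂ = L₁ ∨ L₂ = L₂ ∨ L₂ = L₃ ∨ L₂ = L₄ := Or.inr (Or.inl rfl)
  have e3 : L₃ = L₁ ∨ L₃ = L₂ ∨ L₃ = L₃ ∨ L₃ = L₄ := Or.inr (Or.inr (Or.inl rfl))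
  have e4 : L₄ = L₁ ∨ L₄ = L₂ ∨ L₄ = L₃ ∨ L₄ = L₄ := Or.inr (Or.inr (Or.inr rfl))
  have b12 := hFle L₁ L₂ L₃ e1 e2 e3 h12 h13 h23
  have b13 := hFle L₁ L₃ L₂ e1 e3 e2 h13 h12 (Ne.symm h23)
  have b14 := hFle L₁ L₄ L₂ e1 e4 e2 h14 h12 (Ne.symm h24)
  have b23 := hFle L₂ L₃ L₁ e2 e3 e1 h23 (Ne.symm h12) (Ne.symm h13)
  have b24 := hFle L₂ L₄ L₁ e2 e4 e1 h24 (Ne.symm h12) (Ne.symm h14)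
  have b34 := hFle L₃ L₄ L₁ e3 e4 e1 h34 (Ne.symm h13) (Ne.symm h14)
  -- the matching constraints (symmetry of `F` folds the two orientations)
  have hsymm : ∀ L L', (F L L').ncard = (F L' L).ncard := by
    intro L L'
    congr 1
    ext K
    exact ⟨hFsymm L L' K, hFsymm L' L K⟩
  have c12_13 := hmatch L₁ L₂ L₃ e1 e2 e3 h12 h13 h23
  have c12_14 := hmatch L₁ L₂ L₄ e1 e2 e4 h12 h14 h24
  have c13_14 := hmatch L₁ L₃ L₄ e1 e3 e4 h13 h14 h34
  have c21_23 := hmatch L₂ L₁ L₃ e2 e1 e3 (Ne.symm h12) h23 h13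
  have c21_24 := hmatch L₂ L₁ L₄ e2 e1 e4 (Ne.symm h12) h24 h14
  have c23_24 := hmatch L₂ L₃ L₄ e2 e3 e4 h23 h24 h34
  have c31_32 := hmatch L₃ L₁ L₂ e3 e1 e2 (Ne.symm h13) (Ne.symm h23) h12
  have c31_34 := hmatch L₃ L₁ L₄ e3 e1 e4 (Ne.symm h13) h34 h14
  have c32_34 := hmatch L₃ L₂ L₄ e3 e2 e4 (Ne.symm h23) h34 h24
  have c41_42 := hmatch L₄ L₁ L₂ e4 e1 e2 (Ne.symm h14) (Ne.symm h24) h12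
  have c41_43 := hmatch L₄ L₁ L₃ e4 e1 e3 (Ne.symm h14) (Ne.symm h34) h13
  have c42_43 := hmatch L₄ L₂ L₃ e4 e2 e3 (Ne.symm h24) (Ne.symm h34) h23
  rw [hsymm L₂ L₁] at c21_23 c21_24
  rw [hsymm L₃ L₁] at c31_32 c31_34
  rw [hsymm L₃ L₂] at c32_34 c31_32
  rw [hsymm L₄ L₁] at c41_42 c41_43
  rw [hsymm L₄ L₂] at c42_43 c41_42
  rw [hsymm L₄ L₃] at c41_43 c42_43
  omega

end S1

end PercRepro
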